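import Summits.MatrixMultiplication.MatrixMultiplication.Theorems.AbelianSTPPCensusGW2Class

/-!
# Fibred Pollard for any number of classes: the per-class inequalities of rule FPq (core of FP2 / FP4 / any `q = M/p`)

Cell mm-stpp (rung F-M1), theory lane «past the walls» (seat mm-stpp-theory, gen 18).  Census-silent ENABLER: the class-level
consequences of «an STPP family lives in a finite abelian group `H` with a subgroup `P`», stated for an ARBITRARY system of coset
representatives — the common core of rule U11-F2 (`AbelianSTPPCensusFP2Sound`, index `2`), rule U11-F4 (`AbelianSTPPCensusFP4Sound`,
index `4`) and of every future rule FPq (`q = |H| / p` classes), with no labelling, no addition table and no bound on `q`.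

Notation (tree `diffUnion`, `repCount`, `Nt` of `AbelianSTPPSieveVP`): `X = ⋃ (B_j − A_j)`, `Y = ⋃ (C_k − B_k)`, `Z′ = ⋃ (C_i − A_i)`,
`r = r_{X,Y}`; `r(c′ − a) = b_i` on `C_i − A_i` (`STPPRepCount.repCount_eq`).  For a subgroup `P` and `g ∈ H`, `FPQ.(S.filter (fun u => u - g ∈ P))` is the part
of a finset `S` in the coset `g + P`.  A finset `G ⊆ H` is a TRANSVERSAL if its elements are pairwise incongruent mod `P`, COMPLETE if
every element of `H` is congruent to one of them.  Fix a target coset `c + P`; the class pairs are `(X_g, Y_{c−g})`, `g ∈ G` — all their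
sums lie in `c + P`, their representation counts add up to at most `r` (transversal) and to at least `r` on `c + P` (complete).
* `FPQ.sum_pairFloor_le` (F1, `|P| = p` PRIME, Pollard inside every coset pair — tree `FP2.pairFloor_le_Nt_coset`): for levels
  `τ_g ≤ min(|X_g|, |Y_{c−g}|)`, `Σ_g τ_g·min(p, |X_g| + |Y_{c−g}| − τ_g) ≤ W·min(T, cap) + T·(p − W)`, `T = Σ_g τ_g`, `W = |Z′ ∩ (c+P)|`,
  `cap ≥ r` on `Z′`;
* `FPQ.vmin_mul_card_le` (F2, `G` complete, any `P`): `vmin·W ≤ Σ_g |X_g|·|Y_{c−g}|` if `vmin ≤ r` on `Z′`;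
* `FPQ.vmin_le_sum_min` (F3, `G` complete): `W ≥ 1 → vmin ≤ Σ_g min(|X_g|, |Y_{c−g}|)`;
* `FPQ.sum_excess_le` (pigeonhole, ANY finite subgroup `P` with `k` elements, no primality): `W ≥ 1 → Σ_g (|X_g| + |Y_{c−g}| − k)₊ ≤ cap`
  — every point of `c + P` is hit at least `|X_g| + |Y_{c−g}| − k` times by the pair `g` (tree `GW2.card_add_card_le_card_add_repCount`);
and the STPP readings `FPQ.classIneq_of_isSTPP`, `FPQ.mass_of_isSTPP`, `FPQ.point_of_isSTPP`, `FPQ.excess_of_isSTPP` (`cap = max b`,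
`vmin = min b`; forms A and C are these statements for the rotated families `(C, A, B)`, `(B, C, A)`, tree `IsSTPP.rotate`, whose difference
unions are the negatives — tree `FP4.diffUnion_swap_eq_image_neg`, `FPQ.card_part_image_neg`).  With `G = {0, g₁}` at `|H| = 2p` these are FP2's `CosetIneq`/mass clauses, with the
four coset labels at `|H| = 4p` FP4's `TargetOK`.
WHAT THIS IS NOT: no shape-level predicate, no checker, no census number, no `ω` statement; necessary conditions only.
References: J. M. Pollard, J. London Math. Soc. (2) 8 (1974) 460–462 (tree `Literature.Combinatorics.Additive.pollard`);
CKSU 2005 Def. 5.1 (`IsSTPP`).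
-/

set_option linter.dupNamespace false -- `MatrixMultiplication.MatrixMultiplication` (summit = problem, D-0017)
set_option autoImplicit false

namespace Summit.MatrixMultiplication.MatrixMultiplication.Theorems

open Finset

namespace FPQ

open Literature.Computability.AlgebraicComplexity STPPRepCount
open scoped Pointwise

variable {H : Type*} [AddCommGroup H] [DecidableEq H]

/-! ### Parts of a finset in the cosets of a subgroup -/

variable (P : AddSubgroup H) [DecidablePred (· ∈ P)]

omit [DecidableEq H] in
/-- Membership in the part `S ∩ (g + P)` (written `S.filter (· − g ∈ P)` throughout). [bookkeeping] -/
theorem mem_part {S : Finset H} {g u : H} : u ∈ S.filter (fun u => u - g ∈ P) ↔ u ∈ S ∧ u - g ∈ P := by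
  rw [mem_filter]

omit [DecidableEq H] in
/-- A part is a subset. [bookkeeping] -/
theorem part_subset (S : Finset H) (g : H) : S.filter (fun u => u - g ∈ P) ⊆ S := filter_subset _ _

omit [DecidableEq H] in
/-- Every element of a part lies in the coset. [bookkeeping] -/
theorem sub_mem_of_mem_part {S : Finset H} {g u : H} (hu : u ∈ S.filter (fun u => u - g ∈ P)) : u - g ∈ P := ((mem_part P).mp hu).2

omit [DecidableEq H] in
/-- The coset `c + P` as a finset has as many elements as `P`. [bookkeeping] -/
theorem card_coset [Fintype H] (c : H) : (univ.filter (fun w : H => w - c ∈ P)).card = (univ.filter (· ∈ P)).card := by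
  refine card_bij' (fun w _ => w - c) (fun v _ => v + c) ?_ ?_ (fun w _ => sub_add_cancel w c) (fun v _ => add_sub_cancel_right v c)
  · intro w hw; exact mem_filter.mpr ⟨mem_univ _, (mem_filter.mp hw).2⟩
  · intro v hv; exact mem_filter.mpr ⟨mem_univ _, by simpa using (mem_filter.mp hv).2⟩

omit [DecidableEq H] in
/-- A part has at most `|P|` elements. [bookkeeping] -/
theorem card_part_le [Fintype H] (S : Finset H) (g : H) : ((S.filter (fun u => u - g ∈ P))).card ≤ (univ.filter (· ∈ P)).card := by
  rw [← card_coset P g]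
  exact card_le_card fun u hu => mem_filter.mpr ⟨mem_univ _, sub_mem_of_mem_part P hu⟩

omit [DecidableEq H] in
/-- Parts at incongruent representatives are disjoint. [bookkeeping] -/
theorem disjoint_part (S : Finset H) {g g' : H} (hgg' : g - g' ∉ P) : Disjoint ((S.filter (fun u => u - g ∈ P))) ((S.filter (fun u => u - g' ∈ P))) := by
  rw [Finset.disjoint_left]
  intro u hu hu'
  apply hgg'
  have h1 := sub_mem_of_mem_part P hu
  have h2 := sub_mem_of_mem_part P hu'
  have : g - g' = (u - g') - (u - g) := by abel
  rw [this]; exact P.sub_mem h2 h1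

/-- The parts of a negated set are the negated parts at the negated representatives: equal cardinalities. [bookkeeping] -/
theorem card_part_image_neg (S : Finset H) (g : H) : (((S.image (fun u => -u)).filter (fun u => u - (-g) ∈ P))).card = ((S.filter (fun u => u - g ∈ P))).card := by
  refine (card_bij' (fun x _ => -x) (fun x _ => -x) ?_ ?_ (fun x _ => neg_neg x) (fun x _ => neg_neg x)).symm
  · intro x hx
    rw [mem_part] at hx ⊢
    refine ⟨mem_image.mpr ⟨x, hx.1, rfl⟩, ?_⟩
    have : -x - -g = -(x - g) := by abel
    rw [this]; exact P.neg_mem hx.2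
  · intro x hx
    rw [mem_part] at hx ⊢
    obtain ⟨y, hy, rfl⟩ := mem_image.mp hx.1
    refine ⟨by simpa using hy, ?_⟩
    have : - -y - g = -(-y - -g) := by abel
    rw [this]; exact P.neg_mem hx.2

/-! ### Representation counts split along the class pairs `(X_g, Y_{c−g})` -/

/-- The sums of the pair `(X_g, Y_{c−g})` lie in `c + P`: the restricted count vanishes off that coset. [bookkeeping] -/
theorem repCount_part_eq_zero (X Y : Finset H) (c g : H) {w : H} (hw : w - c ∉ P) :
    repCount ((X.filter (fun u => u - g ∈ P))) ((Y.filter (fun u => u - (c - g) ∈ P))) w = 0 := by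
  refine FP2.repCount_eq_zero fun u hu v hv huv => hw ?_
  have h1 := sub_mem_of_mem_part P hu
  have h2 := sub_mem_of_mem_part P hv
  have : w - c = (u - g) + (v - (c - g)) := by rw [← huv]; abel
  rw [this]; exact P.add_mem h1 h2

/-- The solution set of one pair at `w`, as used by `repCount`. [bookkeeping] -/
theorem mem_pairSol {U V : Finset H} {w : H} {q : H × H} :
    q ∈ (U ×ˢ V).filter (fun q => q.1 + q.2 = w) ↔ (q.1 ∈ U ∧ q.2 ∈ V) ∧ q.1 + q.2 = w := by
  rw [mem_filter, mem_product]

/-- **Transversal ⇒ the pair counts add up to at most `r`.**  For pairwise incongruent representatives `G`, the solution sets of the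
pairs `(X_g, Y_{c−g})` are disjoint parts of the solution set of `(X, Y)`. [bookkeeping] -/
theorem sum_repCount_part_le (X Y : Finset H) (G : Finset H) (hG : ∀ g ∈ G, ∀ g' ∈ G, g - g' ∈ P → g = g') (c w : H) :
    ∑ g ∈ G, repCount ((X.filter (fun u => u - g ∈ P))) ((Y.filter (fun u => u - (c - g) ∈ P))) w ≤ repCount X Y w := by
  unfold repCount
  set T : H → Finset (H × H) := fun g => ((X.filter (fun u => u - g ∈ P)) ×ˢ (Y.filter (fun u => u - (c - g) ∈ P))).filter (fun q => q.1 + q.2 = w) with hT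
  have hsub : ∀ g ∈ G, T g ⊆ (X ×ˢ Y).filter (fun q => q.1 + q.2 = w) := by
    intro g _ q hq
    rw [hT, mem_pairSol] at hq
    rw [mem_pairSol]
    exact ⟨⟨part_subset P X g hq.1.1, part_subset P Y (c - g) hq.1.2⟩, hq.2⟩
  have hdis : (G : Set H).PairwiseDisjoint T := by
    intro g hg g' hg' hne
    rw [Function.onFun, Finset.disjoint_left]
    intro q hq hq'
    rw [hT, mem_pairSol] at hq hq'
    refine hne (hG g hg g' hg' ?_)
    have h1 := sub_mem_of_mem_part P hq.1.1
    have h2 := sub_mem_of_mem_part P hq'.1.1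
    have : g - g' = (q.1 - g') - (q.1 - g) := by abel
    rw [this]; exact P.sub_mem h2 h1
  rw [← card_biUnion hdis]
  exact card_le_card (biUnion_subset.mpr hsub)

/-- **Complete ⇒ on the target coset the pair counts add up to at least `r`.**  If every element of `H` is congruent to a
representative, a solution `u + v = w` with `w ∈ c + P` belongs to the pair of the representative of `u`. [bookkeeping] -/
theorem repCount_le_sum_repCount_part (X Y : Finset H) (G : Finset H) (hGc : ∀ h : H, ∃ g ∈ G, h - g ∈ P) (c : H) {w : H}
    (hw : w - c ∈ P) : repCount X Y w ≤ ∑ g ∈ G, repCount ((X.filter (fun u => u - g ∈ P))) ((Y.filter (fun u => u - (c - g) ∈ P))) w := by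
  unfold repCount
  set T : H → Finset (H × H) := fun g => ((X.filter (fun u => u - g ∈ P)) ×ˢ (Y.filter (fun u => u - (c - g) ∈ P))).filter (fun q => q.1 + q.2 = w) with hT
  have hcov : (X ×ˢ Y).filter (fun q => q.1 + q.2 = w) ⊆ G.biUnion T := by
    intro q hq
    rw [mem_pairSol] at hq
    obtain ⟨g, hg, hug⟩ := hGc q.1
    rw [mem_biUnion]
    refine ⟨g, hg, ?_⟩
    rw [hT, mem_pairSol, mem_part, mem_part]
    refine ⟨⟨⟨hq.1.1, hug⟩, ⟨hq.1.2, ?_⟩⟩, hq.2⟩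
    have : q.2 - (c - g) = (w - c) - (q.1 - g) := by rw [← hq.2]; abel
    rw [this]; exact P.sub_mem hw hug
  exact (card_le_card hcov).trans card_biUnion_le

/-! ### (F1) Pollard in every class pair under one ceiling (prime `|P|`) -/

/-- **(F1), the class inequality of rule FPq.**  `|P| = p` prime; `G` pairwise incongruent representatives; target coset `c + P` containing
`Zc`, on which `r_{X,Y} ≤ cap`; levels `τ_g ≤ min(|X_g|, |Y_{c−g}|)`.  Then the Pollard floors of the class pairs (tree `FP2.pairFloor p f g τ =
τ·min(p, f + g − τ)`) are jointly below the ceiling: `Σ_{g ∈ G} pairFloor ≤ |Zc|·min(T, cap) + T·(p − |Zc|)`, `T = Σ_{g ∈ G} τ_g` — each class pair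
satisfies Pollard's theorem inside `P ≃+ ℤ/p` (tree `FP2.pairFloor_le_Nt_coset`), `Σ_g min(τ_g, r_g) ≤ min(T, Σ_g r_g) ≤ min(T, r)` pointwise on
`c + P`, and `min(T, r) ≤ min(T, cap)` on `Zc`, `≤ T` on the other `p − |Zc|` points. [cite: Pollard1974, Thm 1] -/
theorem sum_pairFloor_le [Fintype H] {p : ℕ} [Fact p.Prime] (hP : (univ.filter (· ∈ P)).card = p) (X Y : Finset H) (G : Finset H)
    (hG : ∀ g ∈ G, ∀ g' ∈ G, g - g' ∈ P → g = g') (c : H) (Zc : Finset H) (hZc : ∀ z ∈ Zc, z - c ∈ P) (cap : ℕ)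
    (hcap : ∀ z ∈ Zc, repCount X Y z ≤ cap) (τ : H → ℕ)
    (hτ : ∀ g ∈ G, τ g ≤ ((X.filter (fun u => u - g ∈ P))).card ∧ τ g ≤ ((Y.filter (fun u => u - (c - g) ∈ P))).card) :
    ∑ g ∈ G, FP2.pairFloor p ((X.filter (fun u => u - g ∈ P))).card ((Y.filter (fun u => u - (c - g) ∈ P))).card (τ g) ≤
      Zc.card * min (∑ g ∈ G, τ g) cap + (∑ g ∈ G, τ g) * (p - Zc.card) := by
  set Q : Finset H := univ.filter (fun w : H => w - c ∈ P) with hQdef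
  have hQ : Q.card = p := by rw [hQdef, card_coset P c, hP]
  have hZQ : Zc ⊆ Q := fun z hz => mem_filter.mpr ⟨mem_univ _, hZc z hz⟩
  set T := ∑ g ∈ G, τ g with hTdef
  -- each pair: Pollard inside its coset pair, and the floor lives on `Q`
  have hNt : ∀ g ∈ G, Nt ((X.filter (fun u => u - g ∈ P))) ((Y.filter (fun u => u - (c - g) ∈ P))) (τ g) = ∑ w ∈ Q, min (τ g) (repCount ((X.filter (fun u => u - g ∈ P))) ((Y.filter (fun u => u - (c - g) ∈ P))) w) := by
    intro g _
    unfold Nt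
    rw [← sum_filter_add_sum_filter_not univ (fun w : H => w - c ∈ P)]
    have hz : ∑ w ∈ univ.filter (fun w : H => ¬ (w - c ∈ P)), min (τ g) (repCount ((X.filter (fun u => u - g ∈ P))) ((Y.filter (fun u => u - (c - g) ∈ P))) w) = 0 :=
      sum_eq_zero fun w hw => by rw [repCount_part_eq_zero P X Y c g (mem_filter.mp hw).2, Nat.min_zero]
    rw [hz, add_zero]
  have hfl : ∀ g ∈ G, FP2.pairFloor p ((X.filter (fun u => u - g ∈ P))).card ((Y.filter (fun u => u - (c - g) ∈ P))).card (τ g) ≤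
      ∑ w ∈ Q, min (τ g) (repCount ((X.filter (fun u => u - g ∈ P))) ((Y.filter (fun u => u - (c - g) ∈ P))) w) := by
    intro g hg
    rw [← hNt g hg]
    exact FP2.pairFloor_le_Nt_coset P hP g (c - g) (fun u hu => sub_mem_of_mem_part P hu) (fun v hv => sub_mem_of_mem_part P hv)
      (hτ g hg).1 (hτ g hg).2
  -- sum of the floors ≤ Σ_{w ∈ Q} min(T, r w)
  have step : ∑ g ∈ G, FP2.pairFloor p ((X.filter (fun u => u - g ∈ P))).card ((Y.filter (fun u => u - (c - g) ∈ P))).card (τ g) ≤ ∑ w ∈ Q, min T (repCount X Y w) := by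
    calc ∑ g ∈ G, FP2.pairFloor p ((X.filter (fun u => u - g ∈ P))).card ((Y.filter (fun u => u - (c - g) ∈ P))).card (τ g)
        ≤ ∑ g ∈ G, ∑ w ∈ Q, min (τ g) (repCount ((X.filter (fun u => u - g ∈ P))) ((Y.filter (fun u => u - (c - g) ∈ P))) w) := sum_le_sum hfl
      _ = ∑ w ∈ Q, ∑ g ∈ G, min (τ g) (repCount ((X.filter (fun u => u - g ∈ P))) ((Y.filter (fun u => u - (c - g) ∈ P))) w) := sum_comm
      _ ≤ ∑ w ∈ Q, min T (repCount X Y w) := by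
          refine sum_le_sum fun w _ => ?_
          have h1 : ∑ g ∈ G, min (τ g) (repCount ((X.filter (fun u => u - g ∈ P))) ((Y.filter (fun u => u - (c - g) ∈ P))) w) ≤ T := by
            rw [hTdef]; exact sum_le_sum fun g _ => min_le_left _ _
          have h2 : ∑ g ∈ G, min (τ g) (repCount ((X.filter (fun u => u - g ∈ P))) ((Y.filter (fun u => u - (c - g) ∈ P))) w) ≤ repCount X Y w :=
            (sum_le_sum fun g _ => min_le_right _ _).trans (sum_repCount_part_le P X Y G hG c w)
          exact le_min h1 h2
  refine step.trans ?_
  -- ceiling: split `Q` into `Zc` and the rest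
  rw [← sum_sdiff hZQ]
  have hA : ∑ w ∈ Q \ Zc, min T (repCount X Y w) ≤ T * (p - Zc.card) := by
    calc ∑ w ∈ Q \ Zc, min T (repCount X Y w) ≤ ∑ w ∈ Q \ Zc, T := sum_le_sum fun w _ => min_le_left _ _
      _ = T * (p - Zc.card) := by rw [sum_const, smul_eq_mul, card_sdiff_of_subset hZQ, hQ, mul_comm]
  have hB : ∑ w ∈ Zc, min T (repCount X Y w) ≤ Zc.card * min T cap := by
    calc ∑ w ∈ Zc, min T (repCount X Y w) ≤ ∑ w ∈ Zc, min T cap := sum_le_sum fun w hw => min_le_min_left _ (hcap w hw)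
      _ = Zc.card * min T cap := by rw [sum_const, smul_eq_mul]
  omega

/-! ### (F2), (F3), pigeonhole: complete systems of representatives, any subgroup -/

/-- **(F2), the mass inequality.**  `G` complete, `Zc ⊆ c + P` with `vmin ≤ r_{X,Y}` on `Zc`: `vmin·|Zc| ≤ Σ_{g ∈ G} |X_g|·|Y_{c−g}|`
(every representation of a point of `c + P` belongs to one of the class pairs). [original] -/
theorem vmin_mul_card_le [Fintype H] (X Y : Finset H) (G : Finset H) (hGc : ∀ h : H, ∃ g ∈ G, h - g ∈ P) (c : H) (Zc : Finset H)
    (hZc : ∀ z ∈ Zc, z - c ∈ P) (vmin : ℕ) (hvmin : ∀ z ∈ Zc, vmin ≤ repCount X Y z) :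
    vmin * Zc.card ≤ ∑ g ∈ G, ((X.filter (fun u => u - g ∈ P))).card * ((Y.filter (fun u => u - (c - g) ∈ P))).card := by
  calc vmin * Zc.card = ∑ z ∈ Zc, vmin := by rw [sum_const, smul_eq_mul, mul_comm]
    _ ≤ ∑ z ∈ Zc, repCount X Y z := sum_le_sum hvmin
    _ ≤ ∑ z ∈ Zc, ∑ g ∈ G, repCount ((X.filter (fun u => u - g ∈ P))) ((Y.filter (fun u => u - (c - g) ∈ P))) z :=
        sum_le_sum fun z hz => repCount_le_sum_repCount_part P X Y G hGc c (hZc z hz)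
    _ = ∑ g ∈ G, ∑ z ∈ Zc, repCount ((X.filter (fun u => u - g ∈ P))) ((Y.filter (fun u => u - (c - g) ∈ P))) z := sum_comm
    _ ≤ ∑ g ∈ G, ((X.filter (fun u => u - g ∈ P))).card * ((Y.filter (fun u => u - (c - g) ∈ P))).card := by
        refine sum_le_sum fun _ _ => ?_
        rw [← FP2.sum_repCount]
        exact sum_le_sum_of_subset (subset_univ _)

/-- **(F3), the pointwise inequality.**  `G` complete, some `z ∈ c + P` with `vmin ≤ r_{X,Y}(z)`: `vmin ≤ Σ_{g ∈ G} min(|X_g|, |Y_{c−g}|)`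
(one pair contributes at most `min(|X_g|, |Y_{c−g}|)` representations of a single point, tree `GW2.repCount_le_card_left/right`). [original] -/
theorem vmin_le_sum_min (X Y : Finset H) (G : Finset H) (hGc : ∀ h : H, ∃ g ∈ G, h - g ∈ P) (c : H) {z : H} (hz : z - c ∈ P)
    (vmin : ℕ) (hvmin : vmin ≤ repCount X Y z) :
    vmin ≤ ∑ g ∈ G, min ((X.filter (fun u => u - g ∈ P))).card ((Y.filter (fun u => u - (c - g) ∈ P))).card :=
  hvmin.trans <| (repCount_le_sum_repCount_part P X Y G hGc c hz).trans <| sum_le_sum fun _ _ =>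
    le_min (GW2.repCount_le_card_left _ _ z) (GW2.repCount_le_card_right _ _ z)

/-- **Pigeonhole multiplicity, any finite subgroup.**  `P` with `k` elements (no primality), `G` pairwise incongruent, `z ∈ c + P` with
`r_{X,Y}(z) ≤ cap`: `Σ_{g ∈ G} (|X_g| + |Y_{c−g}| − k)₊ ≤ cap` — the pair `g` alone represents `z` at least `|X_g| + |Y_{c−g}| − k` times
(`X_g` and `z − Y_{c−g}` are subsets of the `k`-element coset `g + P`, tree `GW2.card_add_card_le_card_add_repCount`), and the pairs' solution
sets are disjoint.  Truncated subtraction. [original] -/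
theorem sum_excess_le [Fintype H] {k : ℕ} (hPk : (univ.filter (· ∈ P)).card = k) (X Y : Finset H) (G : Finset H)
    (hG : ∀ g ∈ G, ∀ g' ∈ G, g - g' ∈ P → g = g') (c : H) {z : H} (hz : z - c ∈ P) (cap : ℕ) (hcap : repCount X Y z ≤ cap) :
    ∑ g ∈ G, (((X.filter (fun u => u - g ∈ P))).card + ((Y.filter (fun u => u - (c - g) ∈ P))).card - k) ≤ cap := by
  have hpair : ∀ g ∈ G, ((X.filter (fun u => u - g ∈ P))).card + ((Y.filter (fun u => u - (c - g) ∈ P))).card - k ≤ repCount ((X.filter (fun u => u - g ∈ P))) ((Y.filter (fun u => u - (c - g) ∈ P))) z := by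
    intro g _
    set Cg : Finset H := univ.filter (fun u : H => u - g ∈ P)
    have hCg : Cg.card = k := by rw [card_coset P g, hPk]
    have hV : (X.filter (fun u => u - g ∈ P)) ⊆ Cg := fun u hu => mem_filter.mpr ⟨mem_univ _, sub_mem_of_mem_part P hu⟩
    have hU : ∀ v ∈ (Y.filter (fun u => u - (c - g) ∈ P)), z - v ∈ Cg := by
      intro v hv
      refine mem_filter.mpr ⟨mem_univ _, ?_⟩
      have : z - v - g = (z - c) - (v - (c - g)) := by abel
      rw [this]; exact P.sub_mem hz (sub_mem_of_mem_part P hv)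
    have h := GW2.card_add_card_le_card_add_repCount (U := (Y.filter (fun u => u - (c - g) ∈ P))) (V := (X.filter (fun u => u - g ∈ P))) (w := z) hV hU
    -- `repCount V U z = repCount U V z` by the swap of the two coordinates
    have hswap : repCount ((Y.filter (fun u => u - (c - g) ∈ P))) ((X.filter (fun u => u - g ∈ P))) z = repCount ((X.filter (fun u => u - g ∈ P))) ((Y.filter (fun u => u - (c - g) ∈ P))) z := by
      unfold repCount
      refine card_bij' (fun q _ => (q.2, q.1)) (fun q _ => (q.2, q.1)) ?_ ?_ (fun q _ => rfl) (fun q _ => rfl)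
      · intro q hq
        rw [mem_pairSol] at hq ⊢
        exact ⟨⟨hq.1.2, hq.1.1⟩, by rw [add_comm]; exact hq.2⟩
      · intro q hq
        rw [mem_pairSol] at hq ⊢
        exact ⟨⟨hq.1.2, hq.1.1⟩, by rw [add_comm]; exact hq.2⟩
    rw [hCg, hswap] at h
    omega
  calc ∑ g ∈ G, (((X.filter (fun u => u - g ∈ P))).card + ((Y.filter (fun u => u - (c - g) ∈ P))).card - k) ≤ ∑ g ∈ G, repCount ((X.filter (fun u => u - g ∈ P))) ((Y.filter (fun u => u - (c - g) ∈ P))) z :=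
        sum_le_sum hpair
    _ ≤ repCount X Y z := sum_repCount_part_le P X Y G hG c z
    _ ≤ cap := hcap

/-! ### The readings for an STPP family (form B; forms A, C = the rotated families) -/

section STPP

variable [Fintype H] {N : ℕ} {A B C : Fin N → Finset H}

omit [Fintype H] in
/-- On `Z′ = ⋃ (C_i − A_i)` the representation count `r_{X,Y}` equals `b_i`, hence lies between any common lower bound `vb` of the `b_i`
and their maximum (tree `STPPRepCount.repCount_eq`). [bookkeeping] -/
theorem repCount_bounds_of_isSTPP (h : IsSTPP A B C) {vb : ℕ} (hvb : ∀ i, vb ≤ (B i).card) {z : H} (hz : z ∈ diffUnion A C) :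
    repCount (diffUnion A B) (diffUnion B C) z ≤ (univ.sup fun i => (B i).card) ∧ vb ≤ repCount (diffUnion A B) (diffUnion B C) z := by
  simp only [diffUnion, mem_biUnion, mem_univ, true_and] at hz
  obtain ⟨i, hi⟩ := hz
  rw [mem_sub] at hi
  obtain ⟨c', hc', a, ha, rfl⟩ := hi
  rw [repCount_eq h ha hc']
  exact ⟨le_sup (f := fun i => (B i).card) (mem_univ i), hvb i⟩

/-- **The class inequality (F1) for an STPP family, form B.**  `P` a subgroup of prime order `p`, `G` pairwise incongruent
representatives, target coset `c + P` carrying `W = |Z′ ∩ (c + P)|` points of `Z′`: for all levels `τ_g ≤ min(|X_g|, |Y_{c−g}|)`,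
`Σ_{g ∈ G} τ_g·min(p, |X_g| + |Y_{c−g}| − τ_g) ≤ W·min(T, max b) + T·(p − W)`, `T = Σ_g τ_g`.  Forms A and C are this statement for the
rotated families `(C, A, B)` and `(B, C, A)` (`IsSTPP.rotate`). [original] -/
theorem classIneq_of_isSTPP (h : IsSTPP A B C) (P : AddSubgroup H) [DecidablePred (· ∈ P)] {p : ℕ} (hp : p.Prime)
    (hP : (univ.filter (· ∈ P)).card = p) (G : Finset H) (hG : ∀ g ∈ G, ∀ g' ∈ G, g - g' ∈ P → g = g') (c : H) (τ : H → ℕ)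
    (hτ : ∀ g ∈ G, τ g ≤ (((diffUnion A B).filter (fun u => u - g ∈ P))).card ∧ τ g ≤ (((diffUnion B C).filter (fun u => u - (c - g) ∈ P))).card) :
    ∑ g ∈ G, FP2.pairFloor p (((diffUnion A B).filter (fun u => u - g ∈ P))).card (((diffUnion B C).filter (fun u => u - (c - g) ∈ P))).card (τ g) ≤
      (((diffUnion A C).filter (fun u => u - c ∈ P))).card * min (∑ g ∈ G, τ g) (univ.sup fun i => (B i).card) +
        (∑ g ∈ G, τ g) * (p - (((diffUnion A C).filter (fun u => u - c ∈ P))).card) := by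
  haveI : Fact p.Prime := ⟨hp⟩
  refine sum_pairFloor_le P hP _ _ G hG c _ (fun _ hz => sub_mem_of_mem_part P hz) _ (fun z hz => ?_) τ hτ
  exact (repCount_bounds_of_isSTPP h (vb := 0) (fun _ => Nat.zero_le _) (part_subset P _ c hz)).1

/-- **The mass inequality (F2) for an STPP family, form B.**  `G` a complete system of representatives (any subgroup `P`), `vb ≤ b_i` for
all `i`: `vb·W ≤ Σ_{g ∈ G} |X_g|·|Y_{c−g}|`. [original] -/
theorem mass_of_isSTPP (h : IsSTPP A B C) (P : AddSubgroup H) [DecidablePred (· ∈ P)] (G : Finset H)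
    (hGc : ∀ u : H, ∃ g ∈ G, u - g ∈ P) (c : H) {vb : ℕ} (hvb : ∀ i, vb ≤ (B i).card) :
    vb * (((diffUnion A C).filter (fun u => u - c ∈ P))).card ≤ ∑ g ∈ G, (((diffUnion A B).filter (fun u => u - g ∈ P))).card * (((diffUnion B C).filter (fun u => u - (c - g) ∈ P))).card :=
  vmin_mul_card_le P _ _ G hGc c _ (fun _ hz => sub_mem_of_mem_part P hz) vb
    fun _ hz => (repCount_bounds_of_isSTPP h hvb (part_subset P _ c hz)).2

omit [Fintype H] in
/-- **The pointwise inequality (F3) for an STPP family, form B.**  `G` complete, the target coset non-empty in `Z′`: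
`vb ≤ Σ_{g ∈ G} min(|X_g|, |Y_{c−g}|)`. [original] -/
theorem point_of_isSTPP (h : IsSTPP A B C) (P : AddSubgroup H) [DecidablePred (· ∈ P)] (G : Finset H)
    (hGc : ∀ u : H, ∃ g ∈ G, u - g ∈ P) (c : H) {vb : ℕ} (hvb : ∀ i, vb ≤ (B i).card) (hW : 1 ≤ (((diffUnion A C).filter (fun u => u - c ∈ P))).card) :
    vb ≤ ∑ g ∈ G, min (((diffUnion A B).filter (fun u => u - g ∈ P))).card (((diffUnion B C).filter (fun u => u - (c - g) ∈ P))).card := by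
  obtain ⟨z, hz⟩ := card_pos.mp (by omega : 0 < (((diffUnion A C).filter (fun u => u - c ∈ P))).card)
  exact vmin_le_sum_min P _ _ G hGc c (sub_mem_of_mem_part P hz) vb (repCount_bounds_of_isSTPP h hvb (part_subset P _ c hz)).2

/-- **The pigeonhole inequality for an STPP family, form B, ANY finite subgroup** `P` with `k` elements: if the target coset meets `Z′` then
`Σ_{g ∈ G} (|X_g| + |Y_{c−g}| − k)₊ ≤ max b` for every family `G` of pairwise incongruent representatives — two heavy classes `X_g`, `Y_{c−g}`
with `|X_g| + |Y_{c−g}| > k + max b` forbid `Z′` in the coset `c + P` altogether. [original] -/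
theorem excess_of_isSTPP (h : IsSTPP A B C) (P : AddSubgroup H) [DecidablePred (· ∈ P)] {k : ℕ} (hPk : (univ.filter (· ∈ P)).card = k)
    (G : Finset H) (hG : ∀ g ∈ G, ∀ g' ∈ G, g - g' ∈ P → g = g') (c : H) (hW : 1 ≤ (((diffUnion A C).filter (fun u => u - c ∈ P))).card) :
    ∑ g ∈ G, ((((diffUnion A B).filter (fun u => u - g ∈ P))).card + (((diffUnion B C).filter (fun u => u - (c - g) ∈ P))).card - k) ≤ (univ.sup fun i => (B i).card) := by
  obtain ⟨z, hz⟩ := card_pos.mp (by omega : 0 < (((diffUnion A C).filter (fun u => u - c ∈ P))).card)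
  exact sum_excess_le P hPk _ _ G hG c (sub_mem_of_mem_part P hz) _
    (repCount_bounds_of_isSTPP h (vb := 0) (fun _ => Nat.zero_le _) (part_subset P _ c hz)).1

end STPP

end FPQ

end Summit.MatrixMultiplication.MatrixMultiplication.Theorems
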